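import Literature.AnabelianGeometry.SemiGraphs.TemperedCompactInVerticialHstar
import HarnessLib

/-!
# [SemiAnbd] Theorem 3.7 (iii) over the level data of a chart, from compatible fixed systems

Mochizuki, *Semi-graphs of anabelioids*, Publ. RIMS **42** (2006), §3, Theorem 3.7 (iii), manuscript
pp. 40–41 [cite: MochizukiSemiAnbd2006, Thm 3.7(iii) pp.40-41].  The printed proof (p. 41, with the
author's *Comments* (2020), item (6)) derives, for a nontrivial compact subgroup `H ⊆ π₁^temp(𝒢)` acting on
the trees `𝒢_{∞,j}`, two intermediate conclusions — "we may assume that there exists a compatible system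
of vertices of `𝒢_{∞,j}`, for `j ∈ J`, each of which is fixed by `H`" and "if `H` fixes two vertices of
`𝒢_{∞,j}`, then these two vertices are joined to one another by a single [closed] edge" (p. 41) — and
concludes (iii) from them.  The derivation of these two conclusions is where print uses "since the
semi-graphs `𝔾_j` are all finite" (p. 41); the tree's route through the condition (∗_j)
(`VerticialLevelData.compactInVerticial_of_hstar`, `TemperedCompactInVerticialHstar.lean`) inherits that
finiteness.

This file proves the LAST step of the printed argument in isolation, over the level data
`D : VerticialLevelData 𝒢 c` of a chart and with NO finiteness of `𝒢` or of the levels: if every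
nontrivial compact subgroup `C` (1) fixes some compatible system of tree vertices and (2) any two
compatible `C`-fixed vertex systems that differ at a level are joined there by a `C`-fixed edge, then the
body of `CompactInVerticial` holds at `𝒢`, `c`, `C` — clause 1 by the identification (I2), "precisely two"
because three pairwise-adjacent distinct vertices would form a circuit of a tree
(`SemiGraph.not_three_pairwise_joined`), and the edge clause by the identification (I3) on the (unique,
hence compatible) joining edges.  Both hypotheses are theorems at finite `𝔾` (they follow from (∗_j)); at
infinite countable `𝔾` they are the honest residual of Theorem 3.7 (iii) (cell gap G-t6g3-2), for which
the (∗_j)-route is not available (the condition (∗_j) fails for nontrivial compact subgroups at a vertex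
of infinite valence, cell record RQ21).

No definitions; nothing here takes a side on [IUTchIII] Cor. 3.12.
-/

namespace Literature.AnabelianGeometry.SemiGraphs

open CategoryTheory Topology

universe v u

namespace SemiGraph

/-- Two branches abutting to distinct vertices are distinct. [cite: MochizukiSemiAnbd2006, §1 p.11] -/
theorem branch_ne_of_abuts_ne {G : SemiGraph.{u}} {c d : G.Branch} {x y : G.Vertex}
    (hc : G.abuts c = some x) (hd : G.abuts d = some y) (hxy : x ≠ y) : c ≠ d := by
  rintro rfl
  rw [hc] at hd
  exact hxy (Option.some_injective _ hd)

/-- An edge has at most two branches: among three branches of one edge, two coincide ("each edge `e`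
being a set of cardinality 2", §1 p. 11). [cite: MochizukiSemiAnbd2006, §1 p.11] -/
theorem branch_eq_or_of_edgeOf {G : SemiGraph.{u}} {e : G.Edge} {a b c : G.Branch}
    (ha : G.edgeOf a = e) (hb : G.edgeOf b = e) (hc : G.edgeOf c = e) : a = b ∨ a = c ∨ b = c := by
  obtain ⟨b₁, b₂, -, -, -, h⟩ := G.two_branches e
  rcases h a ha with rfl | rfl <;> rcases h b hb with rfl | rfl <;>
    rcases h c hc with rfl | rfl <;> simp

/-- **No triangles in a tree**: three pairwise distinct vertices of a tree cannot be pairwise joined by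
edges (the walk `x – e₁ – y – e₂ – z` and the edge `x – e₃ – z` would be two distinct paths of the
barycentric subdivision, which is acyclic).  This is the combinatorial fact behind "then it is contained in
precisely two verticial subgroups" (Thm. 3.7 (iii), p. 40). [cite: MochizukiSemiAnbd2006, Thm 3.7(iii) pp.40-41] -/
theorem not_three_pairwise_joined {G : SemiGraph.{u}} (hG : G.IsTree) {x y z : G.Vertex}
    (hxy : x ≠ y) (hyz : y ≠ z) (hxz : x ≠ z) {e₁ e₂ e₃ : G.Edge} {c₁ d₁ c₂ d₂ c₃ d₃ : G.Branch}
    (hc₁ : G.edgeOf c₁ = e₁) (hd₁ : G.edgeOf d₁ = e₁) (hc₁x : G.abuts c₁ = some x)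
    (hd₁y : G.abuts d₁ = some y) (hc₂ : G.edgeOf c₂ = e₂) (hd₂ : G.edgeOf d₂ = e₂)
    (hc₂y : G.abuts c₂ = some y) (hd₂z : G.abuts d₂ = some z) (hc₃ : G.edgeOf c₃ = e₃)
    (hd₃ : G.edgeOf d₃ = e₃) (hc₃x : G.abuts c₃ = some x) (hd₃z : G.abuts d₃ = some z) : False := by
  have hA : G.subdivision.IsAcyclic := hG.isTree.isAcyclic
  -- the two edges `e₁`, `e₂` are distinct: else `c₁, d₁, d₂` are three branches of one edge
  have he₁₂ : e₁ ≠ e₂ := by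
    rintro rfl
    rcases branch_eq_or_of_edgeOf hc₁ hd₁ hd₂ with h | h | h
    · exact branch_ne_of_abuts_ne hc₁x hd₁y hxy h
    · exact branch_ne_of_abuts_ne hc₁x hd₂z hxz h
    · exact branch_ne_of_abuts_ne hd₁y hd₂z hyz h
  -- distinctness of the branches met along `x – e₁ – y – e₂ – z`
  have hc₁d₁ : c₁ ≠ d₁ := branch_ne_of_abuts_ne hc₁x hd₁y hxy
  have hc₁c₂ : c₁ ≠ c₂ := branch_ne_of_abuts_ne hc₁x hc₂y hxy
  have hc₁d₂ : c₁ ≠ d₂ := branch_ne_of_abuts_ne hc₁x hd₂z hxz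
  have hd₁c₂ : d₁ ≠ c₂ := by
    rintro rfl
    exact he₁₂ (hd₁.symm.trans hc₂)
  have hd₁d₂ : d₁ ≠ d₂ := branch_ne_of_abuts_ne hd₁y hd₂z hyz
  have hc₂d₂ : c₂ ≠ d₂ := branch_ne_of_abuts_ne hc₂y hd₂z hyz
  have hc₃d₃ : c₃ ≠ d₃ := branch_ne_of_abuts_ne hc₃x hd₃z hxz
  -- adjacency steps of the subdivision
  have adjVB : ∀ {v : G.Vertex} {b : G.Branch}, G.abuts b = some v →
      G.subdivision.Adj (Sum.inl v) (Sum.inr (Sum.inr b)) :=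
    fun {v b} h => (G.subdivision_adj_inl_iff v _).mpr ⟨b, h, rfl⟩
  have adjBE : ∀ {e : G.Edge} {b : G.Branch}, G.edgeOf b = e →
      G.subdivision.Adj (Sum.inr (Sum.inr b)) (Sum.inr (Sum.inl e)) :=
    fun {e b} h => (G.subdivision_adj_branch_iff b _).mpr (Or.inl (by rw [h]))
  have adjEB : ∀ {e : G.Edge} {b : G.Branch}, G.edgeOf b = e →
      G.subdivision.Adj (Sum.inr (Sum.inl e)) (Sum.inr (Sum.inr b)) :=
    fun {e b} h => (G.subdivision_adj_edge_iff e _).mpr ⟨b, h, rfl⟩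
  have adjBV : ∀ {v : G.Vertex} {b : G.Branch}, G.abuts b = some v →
      G.subdivision.Adj (Sum.inr (Sum.inr b)) (Sum.inl v) :=
    fun {v b} h => (G.subdivision_adj_branch_iff b _).mpr (Or.inr ⟨v, h, rfl⟩)
  -- the long path `x – c₁ – e₁ – d₁ – y – c₂ – e₂ – d₂ – z`
  let p : G.subdivision.Walk (Sum.inl x) (Sum.inl z) :=
    SimpleGraph.Walk.cons (adjVB hc₁x) (SimpleGraph.Walk.cons (adjBE hc₁)
      (SimpleGraph.Walk.cons (adjEB hd₁) (SimpleGraph.Walk.cons (adjBV hd₁y)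
        (SimpleGraph.Walk.cons (adjVB hc₂y) (SimpleGraph.Walk.cons (adjBE hc₂)
          (SimpleGraph.Walk.cons (adjEB hd₂) (SimpleGraph.Walk.cons (adjBV hd₂z)
            SimpleGraph.Walk.nil)))))))
  -- the short path `x – c₃ – e₃ – d₃ – z`
  let q : G.subdivision.Walk (Sum.inl x) (Sum.inl z) :=
    SimpleGraph.Walk.cons (adjVB hc₃x) (SimpleGraph.Walk.cons (adjBE hc₃)
      (SimpleGraph.Walk.cons (adjEB hd₃) (SimpleGraph.Walk.cons (adjBV hd₃z) SimpleGraph.Walk.nil)))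
  have hp : p.IsPath := by
    simp [p, SimpleGraph.Walk.isPath_def, hxy, hyz, hxz, hc₁d₁, hc₁c₂, hc₁d₂, hd₁c₂, hd₁d₂, hc₂d₂, he₁₂]
  have hq : q.IsPath := by
    simp [q, SimpleGraph.Walk.isPath_def, hxz, hc₃d₃]
  have h := congrArg (fun r : G.subdivision.Path _ _ => r.1.length) (hA.path_unique ⟨p, hp⟩ ⟨q, hq⟩)
  simp [p, q] at h

end SemiGraph

namespace ProfiniteSemiGraph

namespace VerticialLevelData

variable {𝒢 : ProfiniteSemiGraph.{u}} {c : TemperedPiChart 𝒢} (D : VerticialLevelData.{v} 𝒢 c)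

/-- **Thm. 3.7 (iii), second part, from the adjacency of compatible fixed systems** ([SemiAnbd] p. 41,
last paragraph of the proof, with Comments (6)(c)): if any two compatible `C`-fixed systems of tree
vertices that differ at a level are joined there by a `C`-fixed edge ("these two vertices are joined to
one another by a single [closed] edge"), and `C` lies in two distinct verticial subgroups `H₁`, `H₂`, then
every verticial subgroup containing `C` is `H₁` or `H₂` (a third one would give three pairwise adjacent
vertices of a tree, `SemiGraph.not_three_pairwise_joined`), and `C` lies in an edge-like subgroup of a
CLOSED edge (identification (I3) on the joining edges, which are unique — `SemiGraph.edge_unique_of_abuts`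
— hence compatible).  Replaces the (∗_j)-steps `atMostTwo_systems_of_hstar` / `adjacent_of_hstar` of
`conj2_of_hstar`; modulo Thm. 3.7 (ii) (`VerticialDistinct`). [cite: MochizukiSemiAnbd2006, Thm 3.7(iii) p.41] -/
theorem conj2_of_fixedSystems (hVD : VerticialDistinct.{u}) (h𝒢 : 𝒢.Thm37Hypotheses) (C : Subgroup c.G)
    (hadj : ∀ x x' : ∀ j, (D.tree j).Vertex,
      (∀ ⦃i j : D.J⦄ (h : i ≤ j), (D.trans h).vertexMap (x j) = x i) →
      (∀ ⦃i j : D.J⦄ (h : i ≤ j), (D.trans h).vertexMap (x' j) = x' i) →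
      (∀ g ∈ C, ∀ j, (D.act j g).hom.vertexMap (x j) = x j) →
      (∀ g ∈ C, ∀ j, (D.act j g).hom.vertexMap (x' j) = x' j) →
      ∀ j, x j ≠ x' j → ∃ (e : (D.tree j).Edge) (b b' : (D.tree j).Branch), b ≠ b' ∧
        (D.tree j).edgeOf b = e ∧ (D.tree j).edgeOf b' = e ∧ (D.tree j).abuts b = some (x j) ∧
        (D.tree j).abuts b' = some (x' j) ∧ ∀ g ∈ C, (D.act j g).hom.edgeMap e = e)
    {v₁ v₂ : 𝒢.graph.Vertex} {H₁ H₂ : Subgroup c.G} (hH₁ : H₁ ∈ verticialSubgroups c v₁)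
    (hH₂ : H₂ ∈ verticialSubgroups c v₂) (hne : H₁ ≠ H₂) (hC₁ : C ≤ H₁) (hC₂ : C ≤ H₂) :
    (∀ (v₃ : 𝒢.graph.Vertex) (H₃ : Subgroup c.G), H₃ ∈ verticialSubgroups c v₃ → C ≤ H₃ →
        H₃ = H₁ ∨ H₃ = H₂) ∧
      ∃ (e : 𝒢.graph.Edge) (L : Subgroup c.G), 𝒢.graph.IsClosedEdge e ∧
        L ∈ edgeLikeSubgroups c e ∧ C ≤ L := by
  classical
  -- (I1): the two verticial subgroups fix compatible systems `x₁`, `x₂`, hence so does `C`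
  obtain ⟨x₁, hx₁c, hx₁f⟩ := D.fix v₁ H₁ hH₁
  obtain ⟨x₂, hx₂c, hx₂f⟩ := D.fix v₂ H₂ hH₂
  have hx₁C : ∀ g ∈ C, ∀ j, (D.act j g).hom.vertexMap (x₁ j) = x₁ j := fun g hg j => hx₁f g (hC₁ hg) j
  have hx₂C : ∀ g ∈ C, ∀ j, (D.act j g).hom.vertexMap (x₂ j) = x₂ j := fun g hg j => hx₂f g (hC₂ hg) j
  -- two verticial subgroups fixing the SAME system coincide (via (I2) and Thm 3.7 (ii))
  have same : ∀ {w w' : 𝒢.graph.Vertex} {K K' : Subgroup c.G}, K ∈ verticialSubgroups c w →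
      K' ∈ verticialSubgroups c w' → ∀ x : ∀ j, (D.tree j).Vertex,
      (∀ ⦃i j : D.J⦄ (h : i ≤ j), (D.trans h).vertexMap (x j) = x i) →
      (∀ g ∈ K, ∀ j, (D.act j g).hom.vertexMap (x j) = x j) →
      (∀ g ∈ K', ∀ j, (D.act j g).hom.vertexMap (x j) = x j) → K = K' := by
    intro w w' K K' hK hK' x hxc hKx hK'x
    obtain ⟨v', H', hH', hstabx⟩ := D.stab x hxc
    have h1 : K = H' := eq_of_le_of_mem_verticialSubgroups hVD h𝒢 c hK hH' fun g hg => hstabx g (hKx g hg)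
    have h2 : K' = H' :=
      eq_of_le_of_mem_verticialSubgroups hVD h𝒢 c hK' hH' fun g hg => hstabx g (hK'x g hg)
    rw [h1, h2]
  -- hence `x₁ ≠ x₂`, at some level `i`
  have hx₁₂ : ∃ i, x₁ i ≠ x₂ i := by
    by_contra hall
    push Not at hall
    have : x₁ = x₂ := funext hall
    subst this
    exact hne (same hH₁ hH₂ x₁ hx₁c hx₁f hx₂f)
  obtain ⟨i, hi⟩ := hx₁₂
  refine ⟨fun v₃ H₃ hH₃ hC₃ => ?_, ?_⟩
  · -- ONLY TWO: a third verticial subgroup containing `C` fixes a third system, which must be `x₁` or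
    -- `x₂` — else at a common level the three vertices are pairwise joined by (fixed) edges of a tree
    obtain ⟨x₃, hx₃c, hx₃f⟩ := D.fix v₃ H₃ hH₃
    have hx₃C : ∀ g ∈ C, ∀ j, (D.act j g).hom.vertexMap (x₃ j) = x₃ j :=
      fun g hg j => hx₃f g (hC₃ hg) j
    by_cases h31 : ∃ i₁, x₃ i₁ ≠ x₁ i₁
    · by_cases h32 : ∃ i₂, x₃ i₂ ≠ x₂ i₂
      · exfalso
        obtain ⟨i₁, hi₁⟩ := h31
        obtain ⟨i₂, hi₂⟩ := h32
        obtain ⟨k, hik, hi₁k⟩ := exists_ge_ge i i₁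
        obtain ⟨j, hkj, hi₂j⟩ := exists_ge_ge k i₂
        have h12 : x₁ j ≠ x₂ j :=
          SemiGraph.ne_of_compatible_ne D.tree (fun i j h => (D.trans h).vertexMap) hx₁c hx₂c hi
            (hik.trans hkj)
        have h31' : x₃ j ≠ x₁ j :=
          SemiGraph.ne_of_compatible_ne D.tree (fun i j h => (D.trans h).vertexMap) hx₃c hx₁c hi₁
            (hi₁k.trans hkj)
        have h32' : x₃ j ≠ x₂ j :=
          SemiGraph.ne_of_compatible_ne D.tree (fun i j h => (D.trans h).vertexMap) hx₃c hx₂c hi₂ hi₂j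
        obtain ⟨e₁, c₁, d₁, -, hc₁, hd₁, hc₁x, hd₁y, -⟩ := hadj x₁ x₂ hx₁c hx₂c hx₁C hx₂C j h12
        obtain ⟨e₂, c₂, d₂, -, hc₂, hd₂, hc₂y, hd₂z, -⟩ := hadj x₂ x₃ hx₂c hx₃c hx₂C hx₃C j h32'.symm
        obtain ⟨e₃, c₃, d₃, -, hc₃, hd₃, hc₃x, hd₃z, -⟩ := hadj x₁ x₃ hx₁c hx₃c hx₁C hx₃C j h31'.symm
        exact SemiGraph.not_three_pairwise_joined (D.isTree j) h12 h32'.symm h31'.symm hc₁ hd₁ hc₁x hd₁y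
          hc₂ hd₂ hc₂y hd₂z hc₃ hd₃ hc₃x hd₃z
      · push Not at h32
        have : x₃ = x₂ := funext h32
        subst this
        exact Or.inr (same hH₃ hH₂ x₃ hx₃c hx₃f hx₂f)
    · push Not at h31
      have : x₃ = x₁ := funext h31
      subst this
      exact Or.inl (same hH₃ hH₁ x₃ hx₃c hx₃f hx₁f)
  · -- THE EDGE: at every level `j ≥ i` the fixed pair is joined by a (unique) edge, fixed by `C`; these
    -- edges form a compatible system above `i`
    have adj : ∀ j : {j : D.J // i ≤ j}, ∃ (e : (D.tree j.1).Edge) (b b' : (D.tree j.1).Branch),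
        b ≠ b' ∧ (D.tree j.1).edgeOf b = e ∧ (D.tree j.1).edgeOf b' = e ∧
        (D.tree j.1).abuts b = some (x₁ j.1) ∧ (D.tree j.1).abuts b' = some (x₂ j.1) ∧
        ∀ g ∈ C, (D.act j.1 g).hom.edgeMap e = e :=
      fun j => hadj x₁ x₂ hx₁c hx₂c hx₁C hx₂C j.1
        (SemiGraph.ne_of_compatible_ne D.tree (fun i j h => (D.trans h).vertexMap) hx₁c hx₂c hi j.2)
    choose ε bε bε' hbb hbε hb'ε hbx hb'x hεfix using adj
    -- compatibility of the edges, by uniqueness of the edge joining `x₁ i'` and `x₂ i'` (`i' ≥ i`)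
    have hεc : ∀ ⦃i' j : {j : D.J // i ≤ j}⦄ (h : i'.1 ≤ j.1), (D.trans h).edgeMap (ε j) = ε i' := by
      intro i' j h
      have hx12 : x₁ i'.1 ≠ x₂ i'.1 :=
        SemiGraph.ne_of_compatible_ne D.tree (fun i j h => (D.trans h).vertexMap) hx₁c hx₂c hi i'.2
      refine SemiGraph.edge_unique_of_abuts (D.isTree i'.1) hx12 (c := (D.trans h).branchMap (bε j))
        (d := (D.trans h).branchMap (bε' j)) (c' := bε i') (d' := bε' i') ?_ ?_ (hbε i') (hb'ε i') ?_ ?_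
        (hbx i') (hb'x i')
      · rw [(D.trans h).edgeOf_branchMap, hbε j]
      · rw [(D.trans h).edgeOf_branchMap, hb'ε j]
      · rw [(D.trans h).abuts_branchMap _ _ (hbx j), hx₁c h]
      · rw [(D.trans h).abuts_branchMap _ _ (hb'x j), hx₂c h]
    -- (I3): the stabiliser of the edge system lies in an edge-like subgroup `L` of the image edge `e`
    obtain ⟨e, L, hL, hpe, hLstab⟩ := D.edge i ε hεc
    refine ⟨e, L, ?_, hL, fun g hg => hLstab g fun j => ⟨hεfix j g hg, fun b hb => ?_⟩⟩
    · -- `e` is closed: the image of the edge `ε i` with its two distinct abutting branches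
      let jj : {j : D.J // i ≤ j} := ⟨i, le_rfl⟩
      rw [← hpe jj]
      refine SemiGraph.isClosedEdge_of_abuts (c := (D.proj jj.1).branchMap (bε jj))
        (c' := (D.proj jj.1).branchMap (bε' jj))
        (fun heq => hbb jj ((D.proj jj.1).branchMap_injOn _ _ (by rw [hbε jj, hb'ε jj]) heq)) ?_ ?_
        ((D.proj jj.1).abuts_branchMap _ _ (hbx jj)) ((D.proj jj.1).abuts_branchMap _ _ (hb'x jj))
      · rw [(D.proj jj.1).edgeOf_branchMap, hbε jj]
      · rw [(D.proj jj.1).edgeOf_branchMap, hb'ε jj]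
    · exact D.branchMap_eq_of_edgeMap_eq j.1 g b (by rw [hb]; exact hεfix j g hg)

/-- **Theorem 3.7 (iii) for the chart `c`, from compatible fixed systems** ([SemiAnbd] p. 41: "there
exists a compatible system of vertices of `𝒢_{∞,j}` … each of which is fixed by `H`" and "if `H` fixes
two vertices … joined to one another by a single [closed] edge"): if every nontrivial compact subgroup
`C` of `π₁^temp(𝒢)` fixes a compatible system of tree vertices of the level data (`hfix`) and any two
compatible `C`-fixed systems differing at a level are joined there by a `C`-fixed edge (`hadj`), then
(1) every compact subgroup lies in a verticial subgroup (identification (I2)), and (2) a nontrivial one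
lying in two distinct verticial subgroups lies in precisely those two and in an edge-like subgroup of a
closed edge (`conj2_of_fixedSystems`) — the body of `ProfiniteSemiGraph.CompactInVerticial` at `𝒢`, `c`,
`C`, modulo Thm. 3.7 (ii) (`VerticialDistinct`) and the existence of verticial subgroups (`hex`, Thm. 3.7
(i)); no finiteness of `𝒢` or of the levels is used. [cite: MochizukiSemiAnbd2006, Thm 3.7(iii) pp.40-41] -/
theorem compactInVerticial_of_fixedSystems (hVD : VerticialDistinct.{u}) (h𝒢 : 𝒢.Thm37Hypotheses)
    (hex : ∀ v : 𝒢.graph.Vertex, (verticialSubgroups c v).Nonempty)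
    (hfix : ∀ C : Subgroup c.G, IsCompact (C : Set c.G) → C ≠ ⊥ →
      ∃ x : ∀ j, (D.tree j).Vertex, (∀ ⦃i j : D.J⦄ (h : i ≤ j), (D.trans h).vertexMap (x j) = x i) ∧
        ∀ g ∈ C, ∀ j, (D.act j g).hom.vertexMap (x j) = x j)
    (hadj : ∀ C : Subgroup c.G, IsCompact (C : Set c.G) → C ≠ ⊥ → ∀ x x' : ∀ j, (D.tree j).Vertex,
      (∀ ⦃i j : D.J⦄ (h : i ≤ j), (D.trans h).vertexMap (x j) = x i) →
      (∀ ⦃i j : D.J⦄ (h : i ≤ j), (D.trans h).vertexMap (x' j) = x' i) →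
      (∀ g ∈ C, ∀ j, (D.act j g).hom.vertexMap (x j) = x j) →
      (∀ g ∈ C, ∀ j, (D.act j g).hom.vertexMap (x' j) = x' j) →
      ∀ j, x j ≠ x' j → ∃ (e : (D.tree j).Edge) (b b' : (D.tree j).Branch), b ≠ b' ∧
        (D.tree j).edgeOf b = e ∧ (D.tree j).edgeOf b' = e ∧ (D.tree j).abuts b = some (x j) ∧
        (D.tree j).abuts b' = some (x' j) ∧ ∀ g ∈ C, (D.act j g).hom.edgeMap e = e)
    (C : Subgroup c.G) (hC : IsCompact (C : Set c.G)) :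
    (∃ (v : 𝒢.graph.Vertex) (H : Subgroup c.G), H ∈ verticialSubgroups c v ∧ C ≤ H) ∧
      (C ≠ ⊥ → ∀ (v₁ v₂ : 𝒢.graph.Vertex) (H₁ H₂ : Subgroup c.G), H₁ ∈ verticialSubgroups c v₁ →
        H₂ ∈ verticialSubgroups c v₂ → H₁ ≠ H₂ → C ≤ H₁ → C ≤ H₂ →
          (∀ (v₃ : 𝒢.graph.Vertex) (H₃ : Subgroup c.G), H₃ ∈ verticialSubgroups c v₃ → C ≤ H₃ →
              H₃ = H₁ ∨ H₃ = H₂) ∧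
          ∃ (e : 𝒢.graph.Edge) (L : Subgroup c.G), 𝒢.graph.IsClosedEdge e ∧
            L ∈ edgeLikeSubgroups c e ∧ C ≤ L) := by
  refine ⟨?_, fun hC1 v₁ v₂ H₁ H₂ hH₁ hH₂ hne hC₁ hC₂ =>
    D.conj2_of_fixedSystems hVD h𝒢 C (hadj C hC hC1) hH₁ hH₂ hne hC₁ hC₂⟩
  by_cases hC1 : C = ⊥
  · -- the trivial subgroup lies in any verticial subgroup (`𝒢` has a vertex, Thm. 3.7 (i))
    obtain ⟨v⟩ := h𝒢.hasVertex
    obtain ⟨H, hH⟩ := hex v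
    exact ⟨v, H, hH, by rw [hC1]; exact bot_le⟩
  · -- (I2) on the compatible fixed system
    obtain ⟨x, hxc, hxf⟩ := hfix C hC hC1
    obtain ⟨v, H, hH, hstab⟩ := D.stab x hxc
    exact ⟨v, H, hH, fun g hg => hstab g (hxf g hg)⟩

/-- **`CompactInVerticial` (Thm. 3.7 (iii) as typed, ALL countable `𝒢`) REDUCED to Thm. 3.7 (ii)
(`VerticialDistinct`), Thm. 3.7 (i) (`VerticialInjective`, for the existence of verticial subgroups) and
the existence, for every chart of every `𝒢` satisfying the hypotheses of Thm. 3.7, of level data on which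
every nontrivial compact subgroup fixes a compatible vertex system and any two compatible fixed systems
differing at a level are joined there by a fixed edge** — the finiteness-free form of
`compactInVerticial_of`. [cite: MochizukiSemiAnbd2006, Thm 3.7(iii) pp.40-41] -/
theorem compactInVerticial_of_fixedSystems' (hVD : VerticialDistinct.{u}) (hVI : VerticialInjective.{u})
    (hD : ∀ (𝒢 : ProfiniteSemiGraph.{u}), 𝒢.Thm37Hypotheses → ∀ (c : TemperedPiChart 𝒢),
      ∃ D : VerticialLevelData.{v} 𝒢 c,
        (∀ C : Subgroup c.G, IsCompact (C : Set c.G) → C ≠ ⊥ →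
          ∃ x : ∀ j, (D.tree j).Vertex, (∀ ⦃i j : D.J⦄ (h : i ≤ j), (D.trans h).vertexMap (x j) = x i) ∧
            ∀ g ∈ C, ∀ j, (D.act j g).hom.vertexMap (x j) = x j) ∧
        (∀ C : Subgroup c.G, IsCompact (C : Set c.G) → C ≠ ⊥ → ∀ x x' : ∀ j, (D.tree j).Vertex,
          (∀ ⦃i j : D.J⦄ (h : i ≤ j), (D.trans h).vertexMap (x j) = x i) →
          (∀ ⦃i j : D.J⦄ (h : i ≤ j), (D.trans h).vertexMap (x' j) = x' i) →
          (∀ g ∈ C, ∀ j, (D.act j g).hom.vertexMap (x j) = x j) →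
          (∀ g ∈ C, ∀ j, (D.act j g).hom.vertexMap (x' j) = x' j) →
          ∀ j, x j ≠ x' j → ∃ (e : (D.tree j).Edge) (b b' : (D.tree j).Branch), b ≠ b' ∧
            (D.tree j).edgeOf b = e ∧ (D.tree j).edgeOf b' = e ∧ (D.tree j).abuts b = some (x j) ∧
            (D.tree j).abuts b' = some (x' j) ∧ ∀ g ∈ C, (D.act j g).hom.edgeMap e = e)) :
    CompactInVerticial.{u} := by
  intro 𝒢 h𝒢 c C hC
  obtain ⟨D, hfix, hadj⟩ := hD 𝒢 h𝒢 c
  exact D.compactInVerticial_of_fixedSystems hVD h𝒢 (fun v => (hVI 𝒢 h𝒢 c v).1) hfix hadj C hC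

end VerticialLevelData

end ProfiniteSemiGraph

end Literature.AnabelianGeometry.SemiGraphs
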